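import Mathlib.Algebra.Field.ULift
import Literature.AnabelianGeometry.AbsoluteAnabelian.AbsTopI.RelativeGCInputs
import Literature.AnabelianGeometry.AbsoluteAnabelian.GaloisTheatersNonVacuity
import Literature.AnabelianGeometry.AbsoluteAnabelian.RelativeGCFunctoriality
import Literature.AnabelianGeometry.AbsoluteAnabelian.SubpadicExamples
import Literature.AnabelianGeometry.AbsoluteAnabelian.SubpadicIsGeneralizedSubpadic
import HarnessLib

/-!
# [AbsTopI] Example 4.8 (i) AND (ii) at ONE class: the one-field point class over `ℚ` satisfies
# both typed hypotheses and all typed clauses (non-vacuity of F-0193 / F-0194 / F-0196 / F-0197)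

S. Mochizuki, *Topics in Absolute Anabelian Geometry I: Generalities* [MochizukiAbsTopI2012], §4,
Example 4.8 (i)/(ii) p. 58; Definition 4.6 (i)/(ii) pp. 55–56.  [pGC] = S. Mochizuki, *The local
pro-p anabelian geometry of curves* (1999) [MochizukiLocAn1999], Def 15.4 (i) p. 77 (number fields
are sub-`p`-adic); [Tpcs] Remark following Def 4.11 p. 44 (sub-`p`-adic ⇒ generalized sub-`p`-adic).

PROOF-ONLY non-vacuity file (no definition / instance / structure) of the abc-iut cell, seat
abc-iut-f-057 (block F; companion of `RelativeGCSchemaNegative.lean` — F-0194/F-0196/F-0197 — and of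
abc-iut-f-056's `RelativeGCEx48Residual.lean` — F-0193).  Those files record that the UNIVERSAL
closures of the four parametrised rows are false and what the rows amount to at a named class.  This
file records the complementary kernel object: the typed hypothesis packages are JOINTLY SATISFIABLE,
NON-VACUOUSLY, by ONE class — so no consumer binding `(𝒟) (h : 𝒟.IsEx48ClassGen p) (hEx : 𝒟.Ex_4_8_i p)`
or the (ii)-analogue argues from contradictory premises, and the functoriality datum required by
`relIsomDGC_of_relHomDGC` is available at the same class.

`exists_isEx48Class_point_model`: for every prime `p`, the class with ONE base field `ℚ` (lifted to
the universe), ONE object over the point extension `Π = G_ℚ ↠ G_ℚ` with ONE scheme endomorphism (the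
identity, an isomorphism) mapped to `[id]`, every object a member and a hyperbolic orbicurve,
`Σ = Primes`, no chain terms, satisfies SIMULTANEOUSLY: `IsEx48ClassGen p` (`ℚ` is generalized
sub-`p`-adic — [Tpcs] Rmk after Def 4.11, the cell's `AbsTopIII.IsSubpadicFor.isGeneralizedSubpadicFor`),
`IsEx48ClassSub p` (`ℚ` is sub-`p`-adic), chain-fullness, the rel-isom-DGC and the rel-hom-DGC (over the
point every outer homomorphism is `[id]`, open and an isomorphism), functoriality of its datum, and
hence `Ex_4_8_i p` and `Ex_4_8_ii p` (cyclotomic and slimness clauses = the cell's kernel theorems, via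
`ex_4_8_i_of_relIsomDGC'` / `ex_4_8_ii_of_relHomDGC`).  HONEST LABEL: DEGENERATE (`Δ = 1`,
tautological 'GC' — the 'GC' content of print lives in [pGC] Thm A / [Tpcs] Thm 4.12 at the
étale-`π₁` class, which the tree cannot construct, abc-iut FOUNDATIONS row 12); a joint-satisfiability
witness about OUR typing; nothing about hyperbolic curves is asserted; nothing here bears on
[IUTchIII] Cor. 3.12 or takes a side; typed ≠ proved.
-/

universe u

namespace Literature.AnabelianGeometry.AbsoluteAnabelian.AbsTopI.ConstructionDataClass

open AugmentedProfiniteGrp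

/-- `ULift ℚ` has characteristic zero (transport along `ULift.ringEquiv`). [folklore] -/
private theorem charZero_ulift_rat' : CharZero (ULift.{u} ℚ) :=
  (ULift.ringEquiv : ULift.{u} ℚ ≃+* ℚ).toRingHom.charZero

/-- `ULift ℚ` is sub-`p`-adic for every prime `p` (`ℚ ↪ ℚ_p`; [pGC] Def 15.4 (i) example (2) p. 77).
[cite: MochizukiLocAn1999, Def 15.4 (i) p.77] -/
private theorem isSubpadicFor_ulift_rat' (p : ℕ) [Fact p.Prime] :
    AbsTopIII.IsSubpadicFor (ULift.{u} ℚ) p := by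
  obtain ⟨⟨L, iL, aL, hfg, ⟨f⟩⟩⟩ := AbsTopIII.IsSubpadicFor.padic p
  exact ⟨⟨L, iL, aL, hfg,
    ⟨f.comp ((algebraMap ℚ ℚ_[p]).comp (ULift.ringEquiv : ULift.{u} ℚ ≃+* ℚ).toRingHom)⟩⟩⟩

/-- **[AbsTopI] Example 4.8 (i) and (ii) at the one-field POINT class over `ℚ`** (non-vacuity of the
rows F-0193 `Ex_4_8_i`, F-0194 `Ex_4_8_ii`, F-0196 `RelHomDGC`, F-0197 `RelIsomDGC` together with BOTH
typed hypotheses `IsEx48ClassGen p` / `IsEx48ClassSub p` and the functoriality datum of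
`relIsomDGC_of_relHomDGC`): for every prime `p` there is a class with nonempty base, nonempty objects,
every object a member, which is the Example-4.8 (i) class AND the Example-4.8 (ii) class in the typed
sense (`ℚ` is generalized sub-`p`-adic and sub-`p`-adic; `Σ = Primes ∋ p`; members = the objects
flagged hyperbolic orbicurves), is chain-full, satisfies the rel-isom-DGC and the rel-hom-DGC, has
functorial data, and satisfies `Ex_4_8_i p` and `Ex_4_8_ii p`.  DEGENERATE (`Δ = 1`): over the point
`Π = G_ℚ ↠ G_ℚ` every outer homomorphism is `[id]`. [cite: MochizukiAbsTopI2012, Ex 4.8 (ii) p.58] -/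
theorem exists_isEx48Class_point_model (p : ℕ) [Fact p.Prime] :
    ∃ 𝒟 : ConstructionDataClass.{u}, Nonempty 𝒟.Base ∧ (∀ b, Nonempty (𝒟.datum b).Obj) ∧
      (∀ b X, 𝒟.Mem b X) ∧ 𝒟.IsEx48ClassGen p ∧ 𝒟.IsEx48ClassSub p ∧ 𝒟.IsChainFull ∧
      𝒟.RelIsomDGC ∧ 𝒟.RelHomDGC ∧ (∀ b, Nonempty (𝒟.datum b).Functoriality) ∧
      Literature.AnabelianGeometry.AbsoluteAnabelian.AbsTopI.ConstructionDataClass.Ex_4_8_i 𝒟 p ∧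
      Literature.AnabelianGeometry.AbsoluteAnabelian.AbsTopI.ConstructionDataClass.Ex_4_8_ii 𝒟 p := by
  haveI : CharZero (ULift.{u} ℚ) := charZero_ulift_rat'
  -- the point extension `Π = G ↠ G` over `G = G_ℚ` and its identity endomorphism over `G`
  let G : ProfiniteGrp.{u} := absoluteGaloisGrp (ULift.{u} ℚ)
  let A : AugmentedProfiniteGrp G :=
    { arith := G, aug := ContinuousMonoidHom.id G, aug_surjective := Function.surjective_id }
  let ι : A.HomOver A := ⟨ContinuousMonoidHom.id _, fun _ => rfl⟩
  -- one object, one scheme morphism (the identity, an isomorphism) mapped to `[id]`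
  let D : RelativeAnabelianDatum G :=
    { Obj := PUnit.{u + 1}, Hom := fun _ _ => PUnit.{u + 1}, IsIso := fun _ => True,
      IsHyperbolicCurve := fun _ => True, primes := Set.univ, grp := fun _ => A,
      outerHom := fun _ => OuterHom.mk ι }
  let 𝒟 : ConstructionDataClass.{u} :=
    { Base := PUnit.{u + 1}
      fld := fun _ => ULift.{u} ℚ
      instField := fun _ => inferInstance
      instCharZero := fun _ => inferInstance
      datum := fun _ => D
      Mem := fun _ _ => True
      IsHyperbolicOrbicurve := fun _ _ => True
      isHyperbolicOrbicurve_of_isHyperbolicCurve := fun _ _ _ => trivial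
      chainTerms := fun _ _ => ∅ }
  have hopen : (OuterHom.mk ι).IsOpen := by
    have hr : Set.range ι.toHom = Set.univ := Set.range_eq_univ.mpr Function.surjective_id
    rw [OuterHom.isOpen_mk, HomOver.IsOpenHom, hr]
    exact isOpen_univ
  have hiso : (OuterHom.mk ι).IsIso := by
    rw [OuterHom.isIso_mk]
    exact Function.bijective_id
  have hGen : 𝒟.IsEx48ClassGen p :=
    ⟨fun _ => (isSubpadicFor_ulift_rat' p).isGeneralizedSubpadicFor, fun _ => Set.mem_univ p,
      fun _ _ => Iff.rfl⟩
  have hSub : 𝒟.IsEx48ClassSub p :=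
    ⟨fun _ => isSubpadicFor_ulift_rat' p, fun _ => rfl, fun _ _ => Iff.rfl⟩
  have hfull : 𝒟.IsChainFull := fun _ _ _ _ ht => ht.elim
  have hIsom : 𝒟.RelIsomDGC := fun _ _ _ _ _ =>
    ⟨fun _ _ => hiso, fun _ _ _ _ _ => Subsingleton.elim _ _,
      fun _ _ => ⟨PUnit.unit, trivial, AugmentedProfiniteGrp.outerHom_point_eq _ _⟩⟩
  have hHom : 𝒟.RelHomDGC := fun _ _ _ _ _ =>
    ⟨fun _ _ => hopen, fun _ _ _ _ _ => Subsingleton.elim _ _,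
      fun _ _ => ⟨PUnit.unit, trivial, AugmentedProfiniteGrp.outerHom_point_eq _ _⟩⟩
  -- the point datum is functorial: identities and composition are the unique morphism, `[id] = [id]`
  have hF : ∀ b, Nonempty (𝒟.datum b).Functoriality := fun _ =>
    ⟨{ id := fun _ => PUnit.unit
       comp := fun _ _ => PUnit.unit
       outerHom_id := fun _ => AugmentedProfiniteGrp.outerHom_point_eq _ _
       outerHom_comp := fun _ _ => AugmentedProfiniteGrp.outerHom_point_eq _ _
       isIso_iff := fun _ => ⟨fun _ => ⟨PUnit.unit, rfl, rfl⟩, fun _ => trivial⟩ }⟩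
  exact ⟨𝒟, ⟨PUnit.unit⟩, fun _ => ⟨PUnit.unit⟩, fun _ _ => trivial, hGen, hSub, hfull, hIsom, hHom,
    hF, ex_4_8_i_of_relIsomDGC' hfull hIsom, ex_4_8_ii_of_relHomDGC hfull hHom⟩

end Literature.AnabelianGeometry.AbsoluteAnabelian.AbsTopI.ConstructionDataClass
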